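import Literature.NumberTheory.LFunctions.DobnerNewmanProofs
import Literature.NumberTheory.LFunctions.DobnerLemma4Proofs
import Literature.NumberTheory.LFunctions.DeBruijnHHeatFlow
import Literature.NumberTheory.LFunctions.KadiriDigammaBounds
import Literature.NumberTheory.LFunctions.LevinsonMontgomery
import Literature.NumberTheory.LFunctions.DobnerLemma3Proofs
import Mathlib

/-!
# Splittings — X-4 × NEWMAN, part 1/2: Newman's conjecture for `Ξ′` — the abstract Bohr–Hurwitz step and the assembly
# `(analytic inputs) ⟹ H_t′ has a non-real zero` (SPLIT-jen-neg gen 4; zero-definition raw form)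

Cell rh-split (brief sha16 f79c5f09d8bcb036), seat rh-split-jen-neg g4, card `run/shared/lean/pub/rh-split/cards/SPLIT-jen-neg.md`
ADDENDUM 5 (booked 03:01Z; refines the annotation of the SURVIVOR row X-4); carved from `HOME/rh-split-jen-neg/g4/SketchG4Newman.lean`
(sha16 3c5fe06033ba3250, 630 l, zero defs, zero sorry) by rh-split-typer-2 g3 on the lead's queue 03:14Z item (1); referee rh-split-ref g2
CONTENT PRE-FILE PASS 03:07:43Z («→ Theorems/Splittings/JensenX4NewmanDeriv ×2 parts, zero-def, re-namespace»; ROUTING OF RECORD: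
Theorems side — «Λ^{(1)} ≥ 0» is not stated in print, so it is not a Literature fact file even though its imports are Literature-only).
TWO-FILE split forced by the 400-line rule: part 1 = §§T1–T2 (`Splittings/JensenX4NewmanDerivStrip.lean`), part 2 = §§T3–T4 + the
main theorem (`Splittings/JensenX4NewmanDeriv.lean`); namespace `…Splittings.JensenX4NewmanDeriv` in both; declarations byte-identical
to the seat's (two docstrings added where the scratch had none).

The seat's summary:

# rh-split-jen-neg g4 — Newman's conjecture for `Ξ′` (kernel; zero `def`s, zero `sorry`)

Main theorem `newmanDeriv : ∀ t < 0, ¬ HasOnlyRealZeros (deriv (deBruijnH t))`: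
every backward heat-flow deformation `H_t` (`t < 0`) of `H_0 = Ξ(·/2)/8` has a DERIVATIVE with a
non-real zero — the `m = 1` case ("`Λ^{(1)} ≥ 0`") of Newman's conjecture for the Ki–Kim–Lee
constants `Λ = Λ^{(0)} ≥ Λ^{(1)} ≥ …` of the derivatives `Ξ^{(m)}`.  Route = Dobner 2021 with one
extra logarithmic factor: the tree's (proved) Thm. 4 `dobner_xiDeformed_approx_holds`,
`ξ_t(J_t s) = γ_t(s)(ζ_t(s) + o(1))` on vertical strips, is differentiated by a Cauchy estimate on
unit discs (T4); the prefactor `γ_t′/γ_t = ½ψ(s/2) + O_t(1) → ∞` (Stirling for `Re ψ`, T3) absorbs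
`ζ_t′ + E′`; so `(ξ_t∘J_t)′ = γ_t′(ζ_t + o(1))`, and the Bohr–Lemma 3–Hurwitz deduction of
`DobnerNewmanProofs.rodgers_tao_of_dobner` is re-run abstractly (T1) for `(ξ_t∘J_t)′/γ_t′`, whose
zeros far up are zeros of `ξ_t′` right of `Re = ½`, i.e. zeros of `H_t′` below the real axis (T2).
Inputs: tree facts `dobner_xiDeformed_approx_holds`, `dobner_zetaDeformed_exists_zero_holds`,
`bohr_almost_periodic_holds` (all proved), `RealZeros.hasDerivAt_Gammaℝ`, `KadiriDigamma.re_digamma_ge`,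
`deriv_deBruijnH`/`differentiable_deBruijnH_holds`, Mathlib Hurwitz/Cauchy/digamma.
Context (splitting X-4 `RH ⟺ RowsFromOne ∧ RowZeroLaguerre`): conjunct `A = RowsFromOne` is
`Ξ′ ∈ 𝓛𝓟`, i.e. `Λ^{(1)} ≤ 0`; with this file `A ⟺ Λ^{(1)} = 0` ("A, if true, is only barely so").
Nothing here is a claim about the truth of RH.

HONEST LABEL: «SPLITTING SEARCH over kernel-typed RH-EQUIVALENCES; a splitting A ∧ B ⟹ RH is CONDITIONAL bookkeeping unless A and B are
both proved; nothing here bears on the truth of RH.»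
-/

set_option linter.dupNamespace false

noncomputable section

open Complex Filter Set Topology Metric

namespace Summit.RiemannHypothesis.RiemannHypothesis.Theorems.Splittings.JensenX4NewmanDeriv

open Literature Literature.NumberTheory.LFunctions

/-! ## T1. Abstract Bohr–Hurwitz step: a function approximating `ζ_t` on vertical strips has zeros far up -/

/-- **T1, abstract Bohr–Hurwitz step.** For `t < 0`: a function `G`, holomorphic far up on every vertical strip and
approximating the deformed zeta function `ζ_t` there uniformly (`‖G − ζ_t‖ ≤ ε` above some height), has zeros arbitrarily far
up in some fixed strip `a ≤ Re s ≤ b` (a zero of `ζ_t` + a zero-free circle + Bohr almost periodicity + Hurwitz, as in the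
tree's `DobnerNewmanProofs.rodgers_tao_of_dobner`). [new-combination; rh-split jen-neg g4] -/
theorem exists_zero_of_strip_approx {t : ℝ} (ht : t < 0) (G : ℂ → ℂ)
    (hG : ∀ a b : ℝ, ∃ y : ℝ, ∀ s : ℂ, a ≤ s.re → s.re ≤ b → y ≤ s.im → DifferentiableAt ℂ G s)
    (happ : ∀ a b : ℝ, a ≤ b → ∀ ε : ℝ, 0 < ε → ∃ y₀ : ℝ, ∀ s : ℂ, a ≤ s.re → s.re ≤ b →
      y₀ ≤ s.im → ‖G s - zetaDeformed t s‖ ≤ ε) :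
    ∃ a b : ℝ, ∀ Y : ℝ, ∃ s : ℂ, a ≤ s.re ∧ s.re ≤ b ∧ Y ≤ s.im ∧ G s = 0 := by
  -- a zero of `ζ_t` and a small circle around it free of zeros (as in the tree's deduction)
  obtain ⟨s₀, hs₀⟩ := dobner_zetaDeformed_exists_zero_holds t ht
  set Z : ℂ → ℂ := zetaDeformed t with hZ
  have hZd : Differentiable ℂ Z := differentiable_zetaDeformed ht
  have hZne : ∃ x : ℂ, Z x ≠ 0 := by
    have habs : LSeries.abscissaOfAbsConv (zetaDeformedCoeff t) < ⊤ := by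
      rw [abscissaOfAbsConv_zetaDeformed ht]; exact bot_lt_top
    have hlim := LSeries.tendsto_atTop habs
    have h1 : zetaDeformedCoeff t 1 = 1 := by simp [zetaDeformedCoeff]
    rw [h1] at hlim
    have hev : ∀ᶠ x : ℝ in atTop, LSeries (zetaDeformedCoeff t) x ≠ 0 :=
      hlim.eventually_ne one_ne_zero
    obtain ⟨x, hx⟩ := hev.exists
    exact ⟨x, hx⟩
  have hiso : ∀ᶠ z in 𝓝[≠] s₀, Z z ≠ 0 := by
    rcases (hZd.analyticAt s₀).eventually_eq_zero_or_eventually_ne_zero with h | h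
    · exfalso
      obtain ⟨x, hx⟩ := hZne
      have hall := (hZd.differentiableOn.analyticOnNhd isOpen_univ).eqOn_zero_of_preconnected_of_eventuallyEq_zero
        isPreconnected_univ (mem_univ s₀) h
      exact hx (hall (mem_univ x))
    · exact h
  obtain ⟨ρ, hρ, hρZ⟩ : ∃ ρ > 0, ∀ z : ℂ, 0 < dist z s₀ → dist z s₀ < ρ → Z z ≠ 0 := by
    rw [eventually_nhdsWithin_iff, Metric.eventually_nhds_iff] at hiso
    obtain ⟨ρ, hρ, h⟩ := hiso
    exact ⟨ρ, hρ, fun z h0 hlt ↦ h hlt (dist_pos.1 h0)⟩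
  set r : ℝ := min (ρ / 2) 1 with hr
  have hr0 : 0 < r := lt_min (half_pos hρ) one_pos
  have hr1 : r ≤ 1 := min_le_right _ _
  have hsphere : ∀ z ∈ sphere s₀ r, Z z ≠ 0 := fun z hz ↦ by
    rw [mem_sphere] at hz
    exact hρZ z (by rw [hz]; exact hr0) (by rw [hz]; exact (min_le_left _ _).trans_lt (half_lt_self hρ))
  -- the strip `[Re s₀ - 1, Re s₀ + 1]` and the holomorphy height
  obtain ⟨yh, hyh⟩ := hG (s₀.re - 1) (s₀.re + 1)
  refine ⟨s₀.re - 1, s₀.re + 1, fun Y ↦ ?_⟩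
  -- heights
  have hT : ∀ m : ℕ, ∃ T : ℝ, max Y yh + |s₀.im| + 1 ≤ T ∧
      (∀ s : ℂ, s ∈ closedBall s₀ r → ‖Z s - Z (s + T * I)‖ < 1 / (m + 1)) ∧
      (∀ s : ℂ, s ∈ closedBall s₀ r → ‖G (s + T * I) - Z (s + T * I)‖ ≤ 1 / (m + 1)) := by
    intro m
    have hε : (0 : ℝ) < 1 / (m + 1) := by positivity
    obtain ⟨y₀, hy₀⟩ := happ (s₀.re - 1) (s₀.re + 1) (by linarith) (1 / (m + 1)) hε
    obtain ⟨τ, -, -, ⟨δ, hδ, hgap⟩, -, hτ⟩ := bohr_almost_periodic_holds (zetaDeformedCoeff t)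
      (s₀.re - 1) (s₀.re + 1) (1 / (m + 1))
      (by rw [abscissaOfAbsConv_zetaDeformed ht]; exact EReal.bot_lt_coe _) (by linarith) hε
    obtain ⟨k, hk⟩ := exists_ge_of_gaps hδ hgap (max (max Y yh + |s₀.im| + 1) (y₀ + |s₀.im| + 1))
    refine ⟨τ k, (le_max_left _ _).trans hk, fun s hs ↦ ?_, fun s hs ↦ ?_⟩
    · have hre : |s.re - s₀.re| ≤ 1 := (abs_re_im_sub_le_of_mem_closedBall hs).1.trans hr1
      obtain ⟨h1, h2⟩ := abs_le.1 hre
      exact hτ k s (by linarith) (by linarith)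
    · have hre : |s.re - s₀.re| ≤ 1 := (abs_re_im_sub_le_of_mem_closedBall hs).1.trans hr1
      have him : |s.im - s₀.im| ≤ 1 := (abs_re_im_sub_le_of_mem_closedBall hs).2.trans hr1
      obtain ⟨h1, h2⟩ := abs_le.1 hre
      obtain ⟨h3, h4'⟩ := abs_le.1 him
      refine hy₀ (s + τ k * I) (by simp; linarith) (by simp; linarith) ?_
      simp only [Complex.add_im, Complex.mul_im, Complex.ofReal_re, Complex.I_im, mul_one,
        Complex.ofReal_im, Complex.I_re, mul_zero, add_zero]
      have := (le_max_right _ _).trans hk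
      linarith [le_abs_self s₀.im, neg_abs_le s₀.im]
  choose T hTY hTbohr hTapprox using hT
  set g : ℕ → ℂ → ℂ := fun m s ↦ G (s + T m * I) with hg
  -- after the shift: imaginary part `≥ max Y yh`, real part within the strip
  have hshift : ∀ m : ℕ, ∀ s ∈ closedBall s₀ r, max Y yh ≤ (s + T m * I).im ∧
      s₀.re - 1 ≤ (s + T m * I).re ∧ (s + T m * I).re ≤ s₀.re + 1 := by
    intro m s hs
    have him : |s.im - s₀.im| ≤ 1 := (abs_re_im_sub_le_of_mem_closedBall hs).2.trans hr1
    have hre : |s.re - s₀.re| ≤ 1 := (abs_re_im_sub_le_of_mem_closedBall hs).1.trans hr1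
    obtain ⟨h3, h4'⟩ := abs_le.1 him
    obtain ⟨h1, h2⟩ := abs_le.1 hre
    simp only [Complex.add_im, Complex.mul_im, Complex.ofReal_re, Complex.I_im, mul_one,
      Complex.ofReal_im, Complex.I_re, mul_zero, add_zero, Complex.add_re, Complex.mul_re, sub_self]
    have hY' := hTY m
    refine ⟨?_, ?_, ?_⟩ <;> linarith [le_abs_self s₀.im, neg_abs_le s₀.im]
  -- uniform convergence `g_m → ζ_t` on the closed disc
  have hunif : TendstoUniformlyOn g Z atTop (closedBall s₀ r) := by
    rw [Metric.tendstoUniformlyOn_iff]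
    intro ε hε
    obtain ⟨M, hM⟩ := exists_nat_gt (2 / ε)
    filter_upwards [eventually_ge_atTop M] with m hm s hs
    have hm' : (2 : ℝ) / ε < m + 1 := hM.trans (by exact_mod_cast Nat.lt_succ_of_le hm)
    have hεm : 2 * (1 / ((m : ℝ) + 1)) < ε := by
      rw [div_lt_iff₀ hε] at hm'
      rw [mul_one_div, div_lt_iff₀ (by positivity)]
      linarith
    set s' : ℂ := s + T m * I with hs'
    have e1 : ‖g m s - Z s'‖ ≤ 1 / (m + 1) := hTapprox m s hs
    have e2 : ‖Z s - Z s'‖ < 1 / (m + 1) := hTbohr m s hs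
    calc dist (Z s) (g m s) = ‖(Z s - Z s') - (g m s - Z s')‖ := by
          rw [dist_eq_norm]; congr 1; ring
      _ ≤ ‖Z s - Z s'‖ + ‖g m s - Z s'‖ := norm_sub_le _ _
      _ < 1 / (m + 1) + 1 / (m + 1) := add_lt_add_of_lt_of_le e2 e1
      _ = 2 * (1 / ((m : ℝ) + 1)) := by ring
      _ < ε := hεm
  -- holomorphy of `g_m` near the disc
  have hdiff : ∀ᶠ m in atTop, DiffContOnCl ℂ (g m) (ball s₀ r) := by
    refine Eventually.of_forall fun m ↦ ?_
    have hcl : closure (ball s₀ r) = closedBall s₀ r := closure_ball s₀ hr0.ne'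
    have hd : ∀ s ∈ closedBall s₀ r, DifferentiableAt ℂ (g m) s := by
      intro s hs
      obtain ⟨hi, hr1', hr2'⟩ := hshift m s hs
      have hGd : DifferentiableAt ℂ G (s + T m * I) :=
        hyh _ hr1' hr2' ((le_max_right _ _).trans hi)
      exact DifferentiableAt.comp (f := fun s : ℂ ↦ s + T m * I) (g := G) s hGd (by fun_prop)
    refine ⟨fun s hs ↦ (hd s (ball_subset_closedBall hs)).differentiableWithinAt, ?_⟩
    rw [hcl]
    exact fun s hs ↦ (hd s hs).continuousAt.continuousWithinAt
  -- Hurwitz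
  have hcont : ContinuousOn Z (sphere s₀ r) := hZd.continuous.continuousOn
  have hz := Complex.eventually_exists_zero_mem_ball_of_tendstoUniformlyOn hr0 hdiff hunif hcont
    hs₀ hsphere
  obtain ⟨m, s, hs, hgs⟩ := hz.exists
  obtain ⟨hi, hr1', hr2'⟩ := hshift m s (ball_subset_closedBall hs)
  exact ⟨s + T m * I, hr1', hr2', (le_max_left _ _).trans hi, hgs⟩

/-! ## T2. Assembly: the two analytic inputs ⇒ `H_t′` has a non-real zero -/

/-- `J_t′(s) = 1 + |t|/(4s)` on the open upper half-plane. -/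
theorem hasDerivAt_dobnerJ (t : ℝ) {s : ℂ} (hs : 0 < s.im) :
    HasDerivAt (dobnerJ t) (1 + (|t| / 4 : ℝ) * s⁻¹) s := by
  unfold dobnerJ
  have hs0 : s ≠ 0 := fun h ↦ by simp [h] at hs
  have hslit : s / (2 * Real.pi) ∈ Complex.slitPlane := by
    rw [Complex.mem_slitPlane_iff]
    right
    rw [show (s : ℂ) / (2 * (Real.pi : ℂ)) = s / ((2 * Real.pi : ℝ) : ℂ) by push_cast; rfl,
      Complex.div_ofReal_im]
    exact (div_pos hs (by positivity)).ne'
  have h1 : HasDerivAt (fun s : ℂ ↦ s / (2 * Real.pi)) (1 / (2 * Real.pi)) s := by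
    simpa using (hasDerivAt_id s).div_const (2 * (Real.pi : ℂ))
  have h2 : HasDerivAt (fun s : ℂ ↦ Complex.log (s / (2 * Real.pi)))
      ((s / (2 * Real.pi))⁻¹ * (1 / (2 * Real.pi))) s := by
    have := HasDerivAt.clog h1 hslit
    simpa [div_eq_mul_inv, mul_comm] using this
  have h3 : (s / (2 * Real.pi))⁻¹ * (1 / (2 * Real.pi)) = s⁻¹ := by
    have hpi : (2 * (Real.pi : ℂ)) ≠ 0 := by
      exact_mod_cast (mul_ne_zero two_ne_zero Real.pi_ne_zero)
    field_simp
  rw [h3] at h2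
  have h4 : HasDerivAt (fun s : ℂ ↦ s + ((|t| / 4 : ℝ) : ℂ) * Complex.log (s / (2 * Real.pi)))
      (1 + ((|t| / 4 : ℝ) : ℂ) * s⁻¹) s := (hasDerivAt_id s).add (h2.const_mul _)
  exact h4

/-- Chain rule for `ξ_t(w) = 8 H_t(−i(2w−1))`: `ξ_t′(w) = −16 i · H_t′(−i(2w−1))`. -/
theorem hasDerivAt_xiDeformed (t : ℝ) (w : ℂ) :
    HasDerivAt (xiDeformed t) (8 * (deriv (deBruijnH t) (-I * (2 * w - 1)) * (-I * 2))) w := by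
  have hH : HasDerivAt (deBruijnH t) (deriv (deBruijnH t) (-I * (2 * w - 1))) (-I * (2 * w - 1)) :=
    ((differentiable_deBruijnH_holds t) _).hasDerivAt
  have hlin : HasDerivAt (fun w : ℂ ↦ -I * (2 * w - 1)) (-I * 2) w := by
    have := ((hasDerivAt_id w).const_mul (2 : ℂ)).sub_const (1 : ℂ)
    simpa using this.const_mul (-I)
  show HasDerivAt (fun w ↦ 8 * deBruijnH t (-I * (2 * w - 1))) _ w
  have := (hH.comp w hlin).const_mul (8 : ℂ)
  exact this

/-- **T2, assembly.** For `t < 0`: if `γ_t′/γ_t → ∞` on vertical strips (`hgrowth`) and the DIFFERENTIATED Dobner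
approximation `(ξ_t ∘ J_t)′ = γ_t′(ζ_t + o(1))` holds there (`happD`), then `H_t′` has a non-real zero (apply `T1` to
`G = (ξ_t ∘ J_t)′/γ_t′`: its zeros far up are zeros of `ξ_t′` right of `Re = ½`, i.e. zeros of `H_t′` off the real axis).
[new-combination; rh-split jen-neg g4] -/
theorem newmanDeriv_of {t : ℝ} (ht : t < 0)
    (hgrowth : ∀ a b : ℝ, a ≤ b → ∀ K : ℝ, ∃ y₁ : ℝ, 0 < y₁ ∧ ∀ s : ℂ, a ≤ s.re → s.re ≤ b →
      y₁ ≤ s.im → K * ‖dobnerGammaT t s‖ ≤ ‖deriv (dobnerGammaT t) s‖)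
    (happD : ∀ a b : ℝ, a ≤ b → ∀ ε : ℝ, 0 < ε → ∃ y₀ : ℝ, ∀ s : ℂ, a ≤ s.re → s.re ≤ b →
      y₀ ≤ s.im → ‖deriv (fun s ↦ xiDeformed t (dobnerJ t s)) s
        - deriv (dobnerGammaT t) s * zetaDeformed t s‖ ≤ ε * ‖deriv (dobnerGammaT t) s‖) :
    ¬ HasOnlyRealZeros (deriv (deBruijnH t)) := by
  intro hreal
  have ht' : 0 < |t| := abs_pos.2 ht.ne
  set F : ℂ → ℂ := fun s ↦ xiDeformed t (dobnerJ t s) with hF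
  set G : ℂ → ℂ := fun s ↦ deriv F s / deriv (dobnerGammaT t) s with hGdef
  -- open upper half-plane: `F`, `γ_t` analytic, hence so are their derivatives
  have hU : IsOpen {s : ℂ | 0 < s.im} := isOpen_lt continuous_const Complex.continuous_im
  have hFan : AnalyticOnNhd ℂ F {s : ℂ | 0 < s.im} := by
    refine DifferentiableOn.analyticOnNhd (fun s hs ↦ ?_) hU
    exact (((differentiable_xiDeformed t) _).comp s (differentiableAt_dobnerJ t hs)).differentiableWithinAt
  have hγan : AnalyticOnNhd ℂ (dobnerGammaT t) {s : ℂ | 0 < s.im} :=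
    DifferentiableOn.analyticOnNhd (fun s hs ↦ (differentiableAt_dobnerGammaT t hs).differentiableWithinAt) hU
  have hF'an := hFan.deriv_of_isOpen hU
  have hγ'an := hγan.deriv_of_isOpen hU
  -- `γ_t′ ≠ 0` high up in any strip (growth with `K = 1`)
  have hγ'ne : ∀ a b : ℝ, a ≤ b → ∃ y₁ : ℝ, 0 < y₁ ∧ ∀ s : ℂ, a ≤ s.re → s.re ≤ b → y₁ ≤ s.im →
      deriv (dobnerGammaT t) s ≠ 0 := by
    intro a b hab
    obtain ⟨y₁, hy₁, h⟩ := hgrowth a b hab 1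
    refine ⟨y₁, hy₁, fun s h1 h2 h3 h0 ↦ ?_⟩
    have := h s h1 h2 h3
    rw [h0, norm_zero, one_mul] at this
    exact (dobnerGammaT_ne_zero t (by linarith : s.im ≠ 0)) (norm_le_zero_iff.1 this)
  have hG : ∀ a b : ℝ, ∃ y : ℝ, ∀ s : ℂ, a ≤ s.re → s.re ≤ b → y ≤ s.im → DifferentiableAt ℂ G s := by
    intro a b
    by_cases hab : a ≤ b
    · obtain ⟨y₁, hy₁, h⟩ := hγ'ne a b hab
      refine ⟨y₁, fun s h1 h2 h3 ↦ ?_⟩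
      have hs : 0 < s.im := by linarith
      exact ((hF'an s hs).differentiableAt).div ((hγ'an s hs).differentiableAt) (h s h1 h2 h3)
    · exact ⟨0, fun s h1 h2 _ ↦ absurd (h1.trans h2) hab⟩
  have happ : ∀ a b : ℝ, a ≤ b → ∀ ε : ℝ, 0 < ε → ∃ y₀ : ℝ, ∀ s : ℂ, a ≤ s.re → s.re ≤ b →
      y₀ ≤ s.im → ‖G s - zetaDeformed t s‖ ≤ ε := by
    intro a b hab ε hε
    obtain ⟨y₀, hy₀⟩ := happD a b hab ε hε
    obtain ⟨y₁, hy₁, h⟩ := hγ'ne a b hab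
    refine ⟨max y₀ y₁, fun s h1 h2 h3 ↦ ?_⟩
    have hne := h s h1 h2 ((le_max_right _ _).trans h3)
    have key := hy₀ s h1 h2 ((le_max_left _ _).trans h3)
    have : G s - zetaDeformed t s =
        (deriv (dobnerGammaT t) s)⁻¹ * (deriv F s - deriv (dobnerGammaT t) s * zetaDeformed t s) := by
      simp only [hGdef]
      field_simp
    rw [this, norm_mul, norm_inv]
    calc ‖deriv (dobnerGammaT t) s‖⁻¹ * ‖deriv F s - deriv (dobnerGammaT t) s * zetaDeformed t s‖
        ≤ ‖deriv (dobnerGammaT t) s‖⁻¹ * (ε * ‖deriv (dobnerGammaT t) s‖) := by gcongr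
      _ = ε := by field_simp [norm_ne_zero_iff.2 hne]
  obtain ⟨a, b, hab⟩ := exists_zero_of_strip_approx ht G hG happ
  -- choose the height so that `Re J_t > 1/2` and `γ_t′ ≠ 0`
  set A : ℝ := 4 / |t| * (3 / 2 - a) with hA
  by_cases hab' : a ≤ b
  swap
  · obtain ⟨s, h1, h2, -, -⟩ := hab 0
    exact hab' (h1.trans h2)
  obtain ⟨y₁, hy₁, hγ1⟩ := hγ'ne a b hab'
  obtain ⟨s, hsa, hsb, hsY, hGs⟩ := hab (max (2 * Real.pi * Real.exp A + 1) y₁)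
  have hs_im : 0 < s.im := lt_of_lt_of_le hy₁ ((le_max_right _ _).trans hsY)
  have hγne : deriv (dobnerGammaT t) s ≠ 0 := hγ1 s hsa hsb ((le_max_right _ _).trans hsY)
  -- `G s = 0` ⇒ `F′(s) = 0` ⇒ `ξ_t′(J_t s) · J_t′(s) = 0`
  have hF0 : deriv F s = 0 := by
    simp only [hGdef, div_eq_zero_iff] at hGs
    exact hGs.resolve_right hγne
  have hJ := hasDerivAt_dobnerJ t hs_im
  have hchain : HasDerivAt F (8 * (deriv (deBruijnH t) (-I * (2 * dobnerJ t s - 1)) * (-I * 2)) *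
      (1 + (|t| / 4 : ℝ) * s⁻¹)) s := (hasDerivAt_xiDeformed t (dobnerJ t s)).comp s hJ
  rw [hchain.deriv] at hF0
  have hs0 : s ≠ 0 := fun h ↦ by simp [h] at hs_im
  have hJ'ne : (1 + (|t| / 4 : ℝ) * s⁻¹ : ℂ) ≠ 0 := by
    intro h
    have h2 : s + ((|t| / 4 : ℝ) : ℂ) = 0 := by
      have := congrArg (fun z ↦ s * z) h
      simp only [mul_add, mul_one, mul_zero] at this
      rwa [mul_left_comm, mul_inv_cancel₀ hs0, mul_one] at this
    have := congrArg Complex.im h2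
    simp at this
    linarith
  have hH0 : deriv (deBruijnH t) (-I * (2 * dobnerJ t s - 1)) = 0 := by
    rcases mul_eq_zero.1 hF0 with h | h
    · rcases mul_eq_zero.1 h with h' | h'
      · norm_num at h'
      · rcases mul_eq_zero.1 h' with h'' | h''
        · exact h''
        · exact absurd h'' (mul_ne_zero (neg_ne_zero.2 I_ne_zero) two_ne_zero)
    · exact absurd h hJ'ne
  have hreal' := hreal _ hH0
  rw [im_neg_I_mul, dobnerJ_re] at hreal'
  -- `Re J_t(s) > 1/2`: contradiction
  have hnorm : 2 * Real.pi * Real.exp A + 1 ≤ ‖s‖ := by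
    have h1 : s.im ≤ ‖s‖ := (le_abs_self _).trans (abs_im_le_norm s)
    linarith [(le_max_left _ _).trans hsY]
  have hpos : 0 < 2 * Real.pi * Real.exp A := by positivity
  have hn0 : 0 < ‖s‖ / (2 * Real.pi) := div_pos (by linarith) (by positivity)
  have hlog : A < Real.log (‖s‖ / (2 * Real.pi)) := by
    rw [Real.lt_log_iff_exp_lt hn0, lt_div_iff₀ (by positivity)]
    linarith
  have hkey : 3 / 2 - a < |t| / 4 * Real.log (‖s‖ / (2 * Real.pi)) := by
    have := mul_lt_mul_of_pos_left hlog (by positivity : (0 : ℝ) < |t| / 4)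
    rwa [show |t| / 4 * A = 3 / 2 - a by rw [hA]; field_simp] at this
  linarith

end Summit.RiemannHypothesis.RiemannHypothesis.Theorems.Splittings.JensenX4NewmanDeriv

end
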